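import Summits.ABC.IUTFork.Cor312EdgeAggregate
import HarnessLib

/-!
# [IUTchIII] Corollary 3.12 — readings of the edge, V bis: the aggregate Reading 4 versus the aggregate inequality under
# intermediate values at one component (proof-only companion of `Cor312EdgeAggregate.lean`)

Record-only file (D-0012) of the abc-iut cell; TAKES NO SIDE. V-e `Cor312EdgeAggregate.lean` (c312-2) types Yamashita's
Reading 4 with the print's GLOBAL quantifier (`AggCongruent` / `PilotNouns.QCongruentSubHullAgg`), proves it sufficient for the
aggregate inequality `AggCor312`, and records in prose ("HOW LITTLE IS LEFT at the aggregate level") that the converse holds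
"as soon as the hulls admit admissible sub-families of every intermediate aggregate log-volume". This companion is the KERNEL
form of that sentence over V-e's abstract finite family `C : ι → Cor312Setting` (RQ7 second pass by abc-iut-w5-d018; sibling of
`Cor312EdgeYamashitaIVT.lean`, which does the single container):

* `aggCongruent_of_aggCor312_of_ivt_at` — intermediate values down to `−∞` at ONE component `i₀` (every `y ≤ ln ν̄(U^{hol}_{i₀})`
  is the log-volume of an admissible sub-region of `U^{hol}_{i₀}`; what an archimedean packet supplies: balls of every radius)
  already turn `AggCor312` into `AggCongruent`: `R_i := U^{hol}_i` for `i ≠ i₀`, the whole deficit absorbed at `i₀`;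
* `aggCongruent_iff_aggCor312_of_ivt_at` — hence the two are EQUIVALENT there, and V-e's separation
  `aggCongruent_tolerates_componentwise_failure` / V-d's `edge_not_imp_yamashita` live on ATOMIC volumes only.

Bookkeeping only: nothing here asserts that any reading is supplied or excluded by [IUTchIII]; typed ≠ proved; no side is
taken on Cor. 3.12. [cite: Yamashita2024IUTSurvey, Cor. 13.13 proof p. 360 ll. 30–40]
-/

noncomputable section

namespace Summit.ABC.IUTFork

open Set

namespace Cor312Proof

variable {ι : Type} [Fintype ι] (C : ι → Cor312Setting)

/-- **Aggregate level (V-e's "HOW LITTLE IS LEFT", kernel form).** For a finite family of component settings,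
intermediate values down to `−∞` at ONE component `i₀` (every `y ≤ ln ν̄(U^{hol}_{i₀})` is the log-volume of an
admissible sub-region of `U^{hol}_{i₀}` — what an archimedean packet supplies) turn the aggregate inequality
`AggCor312` into the aggregate Reading 4 `AggCongruent`: take `R_i := U^{hol}_i` for `i ≠ i₀` and absorb the whole
deficit `Σ_i ln ν̄(Q_i) − Σ_{i ≠ i₀} ln ν̄(U^{hol}_i) ≤ ln ν̄(U^{hol}_{i₀})` at `i₀`. [folklore] -/
theorem aggCongruent_of_aggCor312_of_ivt_at [DecidableEq ι] (i₀ : ι)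
    (ivt : ∀ y : ℝ, y ≤ (C i₀).logvol (C i₀).Uhol →
      ∃ R, (C i₀).Adm R ∧ R ⊆ (C i₀).Uhol ∧ (C i₀).logvol R = y)
    (h : AggCor312 C) : AggCongruent C := by
  classical
  -- the deficit to be absorbed at `i₀`
  set y : ℝ := aggNegAbsLogq C - ∑ i ∈ Finset.univ.erase i₀, (C i).negLogTheta with hy
  have hsplit : aggNegLogTheta C = (C i₀).negLogTheta + ∑ i ∈ Finset.univ.erase i₀, (C i).negLogTheta := by
    unfold aggNegLogTheta
    exact (Finset.add_sum_erase _ (fun i => (C i).negLogTheta) (Finset.mem_univ i₀)).symm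
  have hyle : y ≤ (C i₀).logvol (C i₀).Uhol := by
    have h' : aggNegAbsLogq C ≤ aggNegLogTheta C := h
    rw [hsplit] at h'
    show y ≤ (C i₀).negLogTheta
    rw [hy]; linarith
  obtain ⟨R₀, hR₀, hsub₀, hvol₀⟩ := ivt y hyle
  refine ⟨Function.update (fun i => (C i).Uhol) i₀ R₀, fun i => ?_, ?_⟩
  · by_cases hi : i = i₀
    · subst hi
      rw [Function.update_self]
      exact ⟨hR₀, hsub₀⟩
    · rw [Function.update_of_ne hi]
      exact ⟨(C i).adm_Uhol, subset_rfl⟩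
  · rw [← Finset.add_sum_erase _ _ (Finset.mem_univ i₀), Function.update_self, hvol₀]
    have hrest : ∑ i ∈ Finset.univ.erase i₀, (C i).logvol (Function.update (fun i => (C i).Uhol) i₀ R₀ i) =
        ∑ i ∈ Finset.univ.erase i₀, (C i).negLogTheta := by
      refine Finset.sum_congr rfl fun i hi => ?_
      rw [Function.update_of_ne (Finset.ne_of_mem_erase hi)]
      rfl
    rw [hrest, hy]
    ring

/-- Hence, with intermediate values at one component, the aggregate Reading 4 and the aggregate inequality are
EQUIVALENT — the separation `aggCongruent_tolerates_componentwise_failure`/`edge_not_imp_yamashita` lives on atomic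
volumes only. [folklore] -/
theorem aggCongruent_iff_aggCor312_of_ivt_at [DecidableEq ι] (i₀ : ι)
    (ivt : ∀ y : ℝ, y ≤ (C i₀).logvol (C i₀).Uhol →
      ∃ R, (C i₀).Adm R ∧ R ⊆ (C i₀).Uhol ∧ (C i₀).logvol R = y) :
    AggCongruent C ↔ AggCor312 C :=
  ⟨aggCor312_of_aggCongruent C, aggCongruent_of_aggCor312_of_ivt_at C i₀ ivt⟩

end Cor312Proof

end Summit.ABC.IUTFork

end
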